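import Summits.AtomisticToContinuum.Crystallization.Theorems.PalmUnimodularRigidityLayeredLawsSelectHcpCertificateDefsC
import Summits.AtomisticToContinuum.Crystallization.Theorems.PalmUnimodularRigidityLayeredLawsSelectHcpLocalChartIff
import Summits.AtomisticToContinuum.Crystallization.Theorems.PalmUnimodularRigidityLayeredLawsSelectHcpCorrMeanZeroOf
import Summits.AtomisticToContinuum.Crystallization.Theorems.PalmUnimodularRigidityLayeredLawsSelectHcpCorrBijection
import Summits.AtomisticToContinuum.Crystallization.Theorems.PalmUnimodularRigidityLayeredLawsSelectHcpCorrReceived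
import Summits.AtomisticToContinuum.Crystallization.Theorems.PalmUnimodularRigidityLayeredLawsSelectHcpCorrSent
import Summits.AtomisticToContinuum.Crystallization.Theorems.PalmUnimodularRigidityLayeredLawsSelectHcpRootedChartsNcard
import Summits.AtomisticToContinuum.Crystallization.Theorems.PalmUnimodularRigidityLayeredLawsSelectHcpAtomsCountRestrict
import Summits.AtomisticToContinuum.Crystallization.Theorems.PalmUnimodularRigidityLayeredLawsSelectHcpIntegralCountRestrict
import Summits.AtomisticToContinuum.Crystallization.Theorems.PalmUnimodularRigidityLayeredLawsSelectHcpPointShift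
import Summits.AtomisticToContinuum.Crystallization.Theorems.PalmUnimodularRigidityCruxesToPalmRigidity
import Summits.AtomisticToContinuum.Crystallization.Theorems.LayeredLawsSelectHcp.Negative.PeriodicEnergy
import Summits.AtomisticToContinuum.Crystallization.Theorems.LayeredLawsSelectHcp.Negative.PeriodicPalmLaw
import Summits.AtomisticToContinuum.Crystallization.Theorems.LayeredLawsSelectHcp.Negative.RootedRedundant
import Summits.AtomisticToContinuum.Crystallization.Theorems.LayeredLawsSelectHcp.Negative.FccModel
import Literature.Probability.Process.PointStationaryTransfer

/-!
# Crux `LayeredLawsSelectHcp` (stmt-AtomisticToContinuum-9226), line `mtp-prestress-split-ergodic-frame`: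
# prelude to the zero mean of directed correctors — translation covariance, finiteness and bounds

Lead c2, cycle 3.  Small lemmas used by the assembly of the registered stub `stub_correctorMeanZero`
(`…CorrMeanZero.lean`): translation covariance of the tube class (`hcpCharted_image_sub`, `good_image_sub`, `separated_image_sub`,
`map_sub_count_restrict`), countability, finiteness (twelve) of the rooted charts in the `IsRootedChart` form, the `12·C` bound on chart
sums, the hat label `ĉ ∈ nearBall` (registered sub-goal `hat_mem_nearBall`, by `decide`), and measurability of finitely supported
functions. [folklore]
-/

noncomputable section

namespace Summit.AtomisticToContinuum.Crystallization.Theorems.PalmUnimodularRigidity.LayeredLawsSelectHcp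

open MeasureTheory Set ProbabilityTheory
open scoped ENNReal
open Literature.MathematicalPhysics.StatisticalMechanics Literature.Geometry.DiscreteGeometry
open Summit.AtomisticToContinuum.Crystallization.Theorems.LayeredLawsSelectHcp.Negative.DiracLaws
  (PointStationary GoodShell Layered BarlowLike)
open Summit.AtomisticToContinuum.Crystallization.Theorems.LayeredLawsSelectHcp.Negative.RootedRedundant
  (rooted_of_pointStationary_layered)
open Summit.AtomisticToContinuum.Crystallization.Theorems.LayeredLawsSelectHcp.Negative.FccModel
  (set_eq_of_count_restrict_eq)
open Summit.AtomisticToContinuum.Crystallization.Theorems.LayeredLawsSelectHcp.Negative.PeriodicEnergy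
  (goodShell_image_sub)
open Summit.AtomisticToContinuum.Crystallization.Theorems.LayeredLawsSelectHcp.Negative.PeriodicPalmLaw
  (map_count_restrict_image)

/-! ## Translation covariance of the tube class -/

/-- `HcpCharted` is translation-covariant. [folklore] -/
theorem hcpCharted_image_sub {S : Set (EuclideanSpace ℝ (Fin 3))} (hS : HcpCharted S) (x : EuclideanSpace ℝ (Fin 3)) :
    HcpCharted ((fun z : EuclideanSpace ℝ (Fin 3) => z - x) '' S) := by
  obtain ⟨Φ, hbij, hbond⟩ := hS
  refine ⟨fun p => Φ p - x, ?_, ?_⟩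
  · have hinj : Set.InjOn (fun z : EuclideanSpace ℝ (Fin 3) => z - x) S := sub_left_injective.injOn
    exact hinj.bijOn_image.comp hbij
  · intro p hp q hq
    show dist p q = 1 ↔ 0 < dist (Φ p - x) (Φ q - x) ∧ dist (Φ p - x) (Φ q - x) ≤ 28 / 25
    rw [hbond p hp q hq, dist_sub_right]

/-- An hcp-charted set is countable. [folklore] -/
theorem hcpCharted_countable' {S : Set (EuclideanSpace ℝ (Fin 3))} (hS : HcpCharted S) : S.Countable := by
  obtain ⟨Φ, hbij, -⟩ := hS
  rw [← hbij.image_eq]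
  refine Set.Countable.image ?_ _
  have : hcpStacking 1 (Real.sqrt (2 / 3)) ⊆ Set.range (fun v : ℤ × ℤ × ℤ => hcpSite 1 (Real.sqrt (2 / 3)) v) := by
    rintro p ⟨k, i, j, rfl⟩
    exact ⟨(k, i, j), rfl⟩
  exact (Set.countable_range _).mono this

/-- Translating the counting measure of a countable set: `(count|S).map (· − y) = count|((· − y) '' S)`. [folklore] -/
theorem map_sub_count_restrict {S : Set (EuclideanSpace ℝ (Fin 3))} (hS : S.Countable) (y : EuclideanSpace ℝ (Fin 3)) :
    Measure.map (fun z => z - y) ((Measure.count : Measure (EuclideanSpace ℝ (Fin 3))).restrict S) =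
      (Measure.count : Measure (EuclideanSpace ℝ (Fin 3))).restrict ((fun z : EuclideanSpace ℝ (Fin 3) => z - y) '' S) := by
  have h := map_count_restrict_image (MeasurableEquiv.subRight y) hS
  have hcoe : ((MeasurableEquiv.subRight y : EuclideanSpace ℝ (Fin 3) ≃ᵐ EuclideanSpace ℝ (Fin 3)) :
      EuclideanSpace ℝ (Fin 3) → EuclideanSpace ℝ (Fin 3)) = fun z => z - y := rfl
  rw [hcoe] at h
  exact h

/-! ## Goodness of the re-rooted configuration -/

/-- Re-rooting a rooted hcp-charted tube configuration at one of its atoms gives a rooted hcp-charted tube configuration. [folklore] -/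
theorem good_image_sub {S : Set (EuclideanSpace ℝ (Fin 3))} (hgood : ∀ x ∈ S, GoodShell S x) (hch : HcpCharted S)
    {y : EuclideanSpace ℝ (Fin 3)} (hy : y ∈ S) :
    (0 : EuclideanSpace ℝ (Fin 3)) ∈ (fun z : EuclideanSpace ℝ (Fin 3) => z - y) '' S ∧
      (∀ x ∈ (fun z : EuclideanSpace ℝ (Fin 3) => z - y) '' S, GoodShell ((fun z : EuclideanSpace ℝ (Fin 3) => z - y) '' S) x) ∧
      HcpCharted ((fun z : EuclideanSpace ℝ (Fin 3) => z - y) '' S) := by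
  refine ⟨⟨y, hy, sub_self y⟩, ?_, hcpCharted_image_sub hch y⟩
  rintro x ⟨p, hp, rfl⟩
  exact goodShell_image_sub y (hgood p hp)

/-- Separation is translation-invariant. [folklore] -/
theorem separated_image_sub {S : Set (EuclideanSpace ℝ (Fin 3))} {δ : ℝ}
    (hsep : ∀ x ∈ S, ∀ x' ∈ S, x ≠ x' → δ ≤ dist x x') (y : EuclideanSpace ℝ (Fin 3)) :
    ∀ x ∈ (fun z : EuclideanSpace ℝ (Fin 3) => z - y) '' S, ∀ x' ∈ (fun z : EuclideanSpace ℝ (Fin 3) => z - y) '' S,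
      x ≠ x' → δ ≤ dist x x' := by
  rintro x ⟨p, hp, rfl⟩ x' ⟨p', hp', rfl⟩ hne
  rw [dist_sub_right]
  exact hsep p hp p' hp' fun h => hne (by rw [h])

/-- The rooted charts of a rooted hcp-charted tube configuration form a finite set (of twelve). [folklore] -/
theorem finite_isRootedChart {S : Set (EuclideanSpace ℝ (Fin 3))} (h0 : (0 : EuclideanSpace ℝ (Fin 3)) ∈ S)
    (hgood : ∀ x ∈ S, GoodShell S x) (hch : HcpCharted S) :
    {X : ℤ × ℤ × ℤ → EuclideanSpace ℝ (Fin 3) | IsRootedChart S X}.Finite ∧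
      {X : ℤ × ℤ × ℤ → EuclideanSpace ℝ (Fin 3) | IsRootedChart S X}.ncard = 12 := by
  have h := tube_rootedCharts_ncard S h0 hgood hch
  rwa [rootedCharts_count_restrict] at h

/-- A chart sum over at most twelve charts of a functional bounded by `C` is bounded by `12 C`. [folklore] -/
theorem abs_finsum_mem_le {A : Set (ℤ × ℤ × ℤ → EuclideanSpace ℝ (Fin 3))} (hA : A.Finite) (hA12 : A.ncard ≤ 12)
    {φ : (ℤ × ℤ × ℤ → EuclideanSpace ℝ (Fin 3)) → ℝ} {C : ℝ} (hC : ∀ X, |φ X| ≤ C) :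
    |∑ᶠ X ∈ A, φ X| ≤ 12 * C := by
  have hC0 : 0 ≤ C := le_trans (abs_nonneg _) (hC 0)
  rw [finsum_mem_eq_finite_toFinset_sum _ hA]
  refine (Finset.abs_sum_le_sum_abs _ _).trans ?_
  calc ∑ X ∈ hA.toFinset, |φ X| ≤ ∑ _X ∈ hA.toFinset, C := Finset.sum_le_sum fun X _ => hC X
    _ = hA.toFinset.card * C := by rw [Finset.sum_const, nsmul_eq_mul]
    _ ≤ 12 * C := by
        have : (hA.toFinset.card : ℝ) ≤ 12 := by
          rw [← Set.ncard_eq_toFinset_card _ hA]; exact_mod_cast hA12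
        exact mul_le_mul_of_nonneg_right this hC0

/-! ## The hat label -/

set_option maxRecDepth 8000 in
/-- The inverse shift label `ĉ` of a near-ball label `c` is a near-ball label (`ĉ = −c` on even layers is the geometric opposite,
`ĉ = c` on odd layers). [folklore] -/
theorem hat_mem_nearBall : ∀ c ∈ nearBall, (if Even c.1 then -c else c) ∈ nearBall := by
  decide

end Summit.AtomisticToContinuum.Crystallization.Theorems.PalmUnimodularRigidity.LayeredLawsSelectHcp

end
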